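import Mathlib
import Summits.Ventures.HodgeRepro.BallGenLemmaW
import Summits.Ventures.HodgeRepro.BallGenHolo
import Summits.Ventures.HodgeRepro.ZariskiBlocks

/-!
# R5 steps (2)+(4)+(5) composed, several simple factors: Lemma W's translates and the rational
point, one vector per (factor, copy) block (seat p3)

`ZariskiLemmaW.lean` composes Lemma W (typer-2's `lemmaW_iter`; p5's `lemmaW_generic` at a generic
point) with the rational point of `ZariskiWedge.lean` for ONE number field `T`.  ROUTE-C R5 step (5)
applies the composition to SEVERAL simple factors `B_i` at once — different CM fields `T_i`,
multiplicity spaces `M^{(i)} ≅ T_i^{m_i}`, `Σ_i g′_i ≤ p` eigenforms in total.  This file restates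
both composed theorems with the several-fields rational point of `ZariskiBlocks.lean`:

* `lemmaW_rational_point_blocks`: dense `Δ ≤ U(p,1)`; `g′ = |ι| ≤ p` continuous fields `F i`, each
  non-zero somewhere (ALL the eigenforms of all the factors, in one list); eigenform `i` sits in the
  block `(e i).1 : β` (its factor and copy) with the embedding `(e i).2 : K (e i).1 → ℂ` (`e`
  injective).  Then there are `γ i ∈ Δ` and a point `z` with `(γ_i^*F_i)(z)` linearly independent,
  and for every family of `ℂ`-linear maps `ω i : ℂ^{m (e i).1} → (𝔹^p → ℂ^p)` whose ranges contain
  the translates, some rational data `v b ∈ K_b^{m b}` (one vector per block) make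
  `(ω i (((e i).2 (v (e i).1 j))_j)) z` linearly independent.
* `lemmaW_rational_point_holo_blocks`: the same at EVERY point of an open dense set for `ℂ`-analytic
  fields (p5's `lemmaW_generic`).

Nothing here says anything about the status of the Hodge conjecture for CM abelian varieties,
which is NOT proved.
-/

set_option autoImplicit false

namespace HodgeRepro.Zariski

open HodgeRepro.BallGen

/-- **Lemma W's translates plus the rational point, several factors (R5 steps (2)+(4)+(5) at one
point).**  Dense `Δ ≤ U(p,1)`; `g′ = |ι| ≤ p` continuous fields `F i : 𝔹^p → ℂ^p`, each non-zero
somewhere; blocks `b : β` with number fields `K b` and multiplicity indices `m b`; `e i = (block,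
embedding)` injective.  Then there are `γ i ∈ Δ` and a point `z` with `(γ_i^*F_i)(z)` linearly
independent, and for every family of `ℂ`-linear maps `ω i : ℂ^{m (e i).1} → (𝔹^p → ℂ^p)` whose
ranges contain the translates `γ_i^*F_i`, some rational `v : (b : β) → m b → K b` makes
`(ω i (((e i).2 (v (e i).1 j))_j)) z` linearly independent. -/
theorem lemmaW_rational_point_blocks {p : ℕ} {Δ : Subgroup (U p)} (hΔ : Dense (Δ : Set (U p)))
    {ι : Type} [Fintype ι] [DecidableEq ι]
    {β : Type*} [Fintype β] [DecidableEq β]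
    (K : β → Type*) [∀ b, Field (K b)] [∀ b, NumberField (K b)]
    (m : β → Type*) [∀ b, Fintype (m b)] [∀ b, DecidableEq (m b)]
    (e : ι → Σ b, (K b →ₐ[ℚ] ℂ)) (he : Function.Injective e)
    (F : ι → Ball p → Fin p → ℂ) (hF : ∀ i, Continuous (F i)) (hF0 : ∀ i, ∃ w, F i w ≠ 0)
    (hcard : Fintype.card ι ≤ p) :
    ∃ γ : ι → U p, (∀ i, γ i ∈ Δ) ∧ ∃ z : Ball p,
      LinearIndependent ℂ (fun i => pullback (γ i) (F i) z) ∧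
      ∀ ω : ∀ i, ((m (e i).1 → ℂ) →ₗ[ℂ] (Ball p → Fin p → ℂ)),
        (∀ i, ∃ w, ω i w = pullback (γ i) (F i)) →
        ∃ v : (b : β) → m b → K b,
          LinearIndependent ℂ fun i => ω i (fun j => (e i).2 (v (e i).1 j)) z := by
  set eq := Fintype.equivFin ι with heq
  obtain ⟨γ', hγ'Δ, z, hz⟩ := lemmaW_iter hΔ (Fintype.card ι) hcard (fun j => F (eq.symm j))
    (fun j => hF _) (fun j => hF0 _)
  have hli : LinearIndependent ℂ fun i => pullback (γ' (eq i)) (F i) z := by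
    have h := hz.comp eq eq.injective
    convert h using 1
    funext i
    simp only [Function.comp, Equiv.symm_apply_apply]
  refine ⟨fun i => γ' (eq i), fun i => hγ'Δ _, z, hli, ?_⟩
  intro ω hω
  choose w hw using hω
  have hli' : LinearIndependent ℂ fun i => ((LinearMap.proj z).comp (ω i)) (w i) := by
    convert hli using 1
    funext i
    rw [LinearMap.comp_apply, LinearMap.proj_apply, hw]
  obtain ⟨v, hv⟩ := exists_rat_linearIndependent_blocks K m e he
    (fun i => (LinearMap.proj z).comp (ω i)) w hli'
  exact ⟨v, hv⟩

open HodgeRepro.BallGen.Holo in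
/-- **Lemma W's translates plus the rational point at a GENERIC point, several factors (analytic
fields).**  Dense `Δ ≤ U(p,1)`; `g′ = |ι| ≤ p` (`ι` non-empty) `ℂ`-analytic fields `F i` on the
ball, each non-zero somewhere; blocks `b : β` with number fields `K b` and multiplicity indices
`m b`; `e i = (block, embedding)` injective.  Then there are `γ i ∈ Δ` and an OPEN DENSE set
`U ⊂ 𝔹^p` such that at every `z ∈ U` the translates `(γ_i^*F_i)(z)` are linearly independent and,
for every family of `ℂ`-linear maps `ω i : ℂ^{m (e i).1} → (𝔹^p → ℂ^p)` whose ranges contain the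
translates, some rational `v : (b : β) → m b → K b` makes `(ω i (((e i).2 (v (e i).1 j))_j)) z`
linearly independent. -/
theorem lemmaW_rational_point_holo_blocks {p : ℕ} {Δ : Subgroup (U p)}
    (hΔ : Dense (Δ : Set (U p))) {ι : Type} [Fintype ι] [DecidableEq ι] [Nonempty ι]
    {β : Type*} [Fintype β] [DecidableEq β]
    (K : β → Type*) [∀ b, Field (K b)] [∀ b, NumberField (K b)]
    (m : β → Type*) [∀ b, Fintype (m b)] [∀ b, DecidableEq (m b)]
    (e : ι → Σ b, (K b →ₐ[ℚ] ℂ)) (he : Function.Injective e)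
    (F : ι → (Fin p → ℂ) → (Fin p → ℂ))
    (hF : ∀ i, AnalyticOnNhd ℂ (F i) (ballSet p)) (hF0 : ∀ i, ∃ w : Ball p, F i w.1 ≠ 0)
    (hcard : Fintype.card ι ≤ p) :
    ∃ γ : ι → U p, (∀ i, γ i ∈ Δ) ∧ ∃ U : Set (Ball p), IsOpen U ∧ Dense U ∧ ∀ z ∈ U,
      LinearIndependent ℂ (fun i => pullback (γ i) (fun w : Ball p => F i w.1) z) ∧
      ∀ ω : ∀ i, ((m (e i).1 → ℂ) →ₗ[ℂ] (Ball p → Fin p → ℂ)),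
        (∀ i, ∃ w, ω i w = pullback (γ i) (fun w : Ball p => F i w.1)) →
        ∃ v : (b : β) → m b → K b,
          LinearIndependent ℂ fun i => ω i (fun j => (e i).2 (v (e i).1 j)) z := by
  classical
  obtain ⟨i₀⟩ := ‹Nonempty ι›
  set eq := Fintype.equivFin ι with heq
  -- pad the `g′` fields to `p` fields with copies of `F i₀`
  set F' : Fin p → (Fin p → ℂ) → (Fin p → ℂ) := fun j =>
    if h : j.val < Fintype.card ι then F (eq.symm ⟨j.val, h⟩) else F i₀ with hF'
  have hF'an : ∀ j, AnalyticOnNhd ℂ (F' j) (ballSet p) := by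
    intro j
    simp only [hF']
    split_ifs <;> exact hF _
  have hF'0 : ∀ j, ∃ w : Ball p, F' j w.1 ≠ 0 := by
    intro j
    simp only [hF']
    split_ifs <;> exact hF0 _
  obtain ⟨γ', hγ'Δ, hopen, hdense⟩ := lemmaW_generic hΔ hF'an hF'0
  set ι' : ι → Fin p := fun i => Fin.castLE hcard (eq i) with hι'
  have hι'inj : Function.Injective ι' := (Fin.castLE_injective hcard).comp eq.injective
  have hF'i : ∀ i, F' (ι' i) = F i := by
    intro i
    simp only [hF', hι', Fin.val_castLE, Fin.is_lt, dif_pos, Fin.eta, Equiv.symm_apply_apply]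
  refine ⟨fun i => γ' (ι' i), fun i => hγ'Δ _, _, hopen, hdense, ?_⟩
  intro z hz
  have hli : LinearIndependent ℂ fun i => pullback (γ' (ι' i)) (fun w : Ball p => F i w.1) z := by
    have h := (hz : LinearIndependent ℂ fun j =>
      pullback (γ' j) (fun w : Ball p => F' j w.1) z).comp ι' hι'inj
    convert h using 1
    funext i
    simp only [Function.comp, hF'i]
  refine ⟨hli, ?_⟩
  intro ω hω
  choose w hw using hω
  have hli' : LinearIndependent ℂ fun i => ((LinearMap.proj z).comp (ω i)) (w i) := by
    convert hli using 1
    funext i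
    rw [LinearMap.comp_apply, LinearMap.proj_apply, hw]
  obtain ⟨v, hv⟩ := exists_rat_linearIndependent_blocks K m e he
    (fun i => (LinearMap.proj z).comp (ω i)) w hli'
  exact ⟨v, hv⟩

end HodgeRepro.Zariski
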